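import Summits.QuantumAdvantage.QuantumAdvantage.Theorems.CubicForrelationNearExactIsExactIsolationSmallN
import Summits.QuantumAdvantage.QuantumAdvantage.Theorems.CubicForrelationNearExactIsExactAffineForm

/-!
# Crux `CubicForrelation.NearExactIsExact` (stmt-QuantumAdvantage-14043), line `direct-sum-amplification`, lead c6:
  stub `stub_affineSliceTypeE` — a 9-variable slice `E(w) ⊕ a₀·D(w)` with `E` cubic and `D` AFFINE is of type E

In the `n = 10` census reduction the 9-variable slice `g₉(w ‖ a₀) = E(w) ⊕ a₀·D(w)` (`w ∈ 𝔽₂⁸`, `E` cubic) must have every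
Walsh coefficient `≡ 8 (mod 16)`; this file shows that is impossible when `D` has degree `≤ 1`: then EVERY Walsh
coefficient of `g₉` is a multiple of `16`.

Proof.
* Peel the last coordinate (`ast_W_snoc`: `SgnForrMem.sum_snoc` + `twist_snoc`):
  `W_{g₉}(x ‖ a) = W_E(x) + (−1)^a · W_{E ⊕ D}(x)`.
* `D` affine (`stub_affineForm`): `(−1)^{D(w)} = (−1)^b (−1)^{c·w}`, so `W_{E⊕D}(x) = (−1)^b W_E(c ⊕ x)`
  (`ast_W_affineTwist`: `(−1)^{c·w}(−1)^{w·x} = (−1)^{w·(c ⊕ x)}`, `twist_bxor_right`).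
* Type constancy of an 8-variable cubic: `W_E = 8u` (`tw_base`, Ax/McEliece) and the parity `x ↦ [u(x) odd]` has degree
  `≤ 0` (`stub_walshTower stub_axParity` at `n = 8`, `j = 3`, `d = 0`), i.e. is constant (`ar_const_of_deg_zero`).
* Hence `W_{g₉}(x ‖ a) = 8 (u(x) ± u(c ⊕ x))` with `u(x) ≡ u(c ⊕ x) (mod 2)`: a multiple of `16`.
Sources: J. Ax, *Zeroes of polynomials over finite fields*, Amer. J. Math. 86 (1964); R. J. McEliece, *Weight congruences
for p-ary cyclic codes*, Discrete Math. 3 (1972); C. Carlet, *Boolean Functions for Cryptography and Coding Theory*, CUP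
2021, §4.1 and Thm 13. Everything below is proved from Mathlib and the tree (the landed `stub_affineForm`, `tw_base`,
`stub_walshTower`, `stub_axParity`, `ar_const_of_deg_zero`); axioms are the standard three.
-/

set_option linter.dupNamespace false -- D-0017: single-problem summit ⇒ `QuantumAdvantage.QuantumAdvantage` by design

noncomputable section

namespace Summit.QuantumAdvantage.QuantumAdvantage.Theorems.CubicForrelation.NearExactIsExact

open Finset
open Literature.Computability.QuantumComplexity
open Literature.Computability.QuantumComplexity.BuzetChailloux (bxor twist_bxor_right)
open Literature.Computability.QuantumComplexity.DerivativeWalsh (W)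

/-! ### Peeling the last coordinate -/

/-- **Walsh peel of one coordinate.** If `g(w ‖ a₀) = E(w) ⊕ (a₀ ∧ D w)` then for every `x` and bit `a`,
`W_g(x ‖ a) = W_E(x) + (−1)^a W_{E ⊕ D}(x)` (split the sum over the last coordinate and factor the character). -/
theorem ast_W_snoc {N : ℕ} (E D : (Fin N → Bool) → Bool) (g : (Fin (N + 1) → Bool) → Bool)
    (hg : ∀ (w : Fin N → Bool) (a₀ : Bool), g (Fin.snoc w a₀) = (E w ^^ (a₀ && D w)))
    (x : Fin N → Bool) (a : Bool) :
    W (fun y => signOf (g y)) (Fin.snoc x a) =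
      W (fun w => signOf (E w)) x + signOf a * W (fun w => signOf (E w ^^ D w)) x := by
  unfold W
  rw [SgnForrMem.sum_snoc (m := N), mul_sum, ← sum_add_distrib]
  refine sum_congr rfl fun w _ => ?_
  simp only [hg, twist_snoc, Fintype.sum_bool, Bool.true_and, Bool.false_and, Bool.xor_false,
    SgnForrMem.signOf_false, mul_one]
  ring

/-- **Walsh transform of an affine twist.** `W_{(−1)^E · (−1)^b (−1)^{c·w}}(x) = (−1)^b W_E(c ⊕ x)`
(`(−1)^{c·w} (−1)^{w·x} = (−1)^{w·(c ⊕ x)}`). -/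
theorem ast_W_affineTwist {N : ℕ} (E : (Fin N → Bool) → Bool) (b : Bool) (c x : Fin N → Bool) :
    W (fun w => signOf (E w) * (signOf b * twist c w)) x = signOf b * W (fun w => signOf (E w)) (bxor c x) := by
  unfold W
  rw [mul_sum]
  refine sum_congr rfl fun w _ => ?_
  dsimp only
  rw [twist_bxor_right, twist_comm c w]
  ring

/-- The parity bookkeeping: if `p` and `q` have the same parity then `p + s q` is even for `s = (−1)^t`. -/
theorem ast_even_signed_sum (p q : ℤ) (h : Odd p ↔ Odd q) (t : Bool) :
    ∃ k : ℤ, (p : ℝ) + signOf t * (q : ℝ) = 2 * (k : ℝ) := by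
  cases t
  · obtain ⟨k, hk⟩ := Int.even_add'.2 h
    exact ⟨k, by rw [SgnForrMem.signOf_false, one_mul]; exact_mod_cast hk.trans (two_mul k).symm⟩
  · obtain ⟨k, hk⟩ := Int.even_sub'.2 h
    refine ⟨k, ?_⟩
    rw [SgnForrMem.signOf_true, neg_one_mul, ← sub_eq_add_neg]
    exact_mod_cast hk.trans (two_mul k).symm

/-! ### The stub -/

/-- **An affine slice is of type E.** If `E : 𝔽₂⁸ → 𝔽₂` is cubic, `D : 𝔽₂⁸ → 𝔽₂` has degree `≤ 1`, and
`g₉(w ‖ a₀) = E(w) ⊕ (a₀ ∧ D w)` on `9` bits, then every Walsh coefficient `W_{g₉}(ξ)` is a multiple of `16`.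
Peel (`ast_W_snoc`), write `(−1)^D = (−1)^b (−1)^{c·w}` (`stub_affineForm`) so that `W_{E⊕D}(x) = (−1)^b W_E(c ⊕ x)`
(`ast_W_affineTwist`), and use the type constancy of the 8-variable cubic `E`: `W_E = 8u` (`tw_base`) with `[u odd]` of
degree `≤ 0` (`stub_walshTower stub_axParity`), hence constant (`ar_const_of_deg_zero`); so
`W_{g₉}(x ‖ a) = 8(u(x) ± u(c ⊕ x)) ∈ 16ℤ`. [Ax 1964 / McEliece 1972 divisibility; Carlet 2021 §4.1, Thm 13] -/
theorem stub_affineSliceTypeE :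
    ∀ (E D : (Fin (4 + 4) → Bool) → Bool) (g₉ : (Fin (4 + 4 + 1) → Bool) → Bool), IsDegLeFun 3 E → IsDegLeFun 1 D →
      (∀ (w : Fin (4 + 4) → Bool) (a₀ : Bool), g₉ (Fin.snoc w a₀) = (E w ^^ (a₀ && D w))) →
      ∀ ξ : Fin (4 + 4 + 1) → Bool, ∃ k : ℤ, W (fun y => signOf (g₉ y)) ξ = 16 * (k : ℝ) := by
  intro E D g₉ hE hD hg ξ
  obtain ⟨c, b, hcb⟩ := stub_affineForm (4 + 4) D hD
  obtain ⟨u, hu⟩ := tw_base E hE 3 (by norm_num)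
  have hP0 : IsDegLeFun 0 (fun x => decide (Odd (u x))) :=
    stub_walshTower stub_axParity (4 + 4) 3 0 E u hE hu (by intro k hk hkn; omega)
  have hξ : ξ = Fin.snoc (Fin.init ξ) (ξ (Fin.last _)) := (Fin.snoc_init_self ξ).symm
  generalize Fin.init ξ = x at hξ
  generalize ξ (Fin.last (4 + 4)) = a at hξ
  subst hξ
  have hED : W (fun w => signOf (E w ^^ D w)) x = signOf b * W (fun w => signOf (E w)) (bxor c x) := by
    rw [← ast_W_affineTwist]
    congr 1
    funext w
    rw [signOf_xor, hcb w]
  have hpar : Odd (u x) ↔ Odd (u (bxor c x)) := by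
    have h := ar_const_of_deg_zero hP0 x (bxor c x)
    simpa only [decide_eq_decide] using h
  obtain ⟨k, hk⟩ := ast_even_signed_sum (u x) (u (bxor c x)) hpar (a ^^ b)
  refine ⟨k, ?_⟩
  rw [ast_W_snoc E D g₉ hg x a, hED, hu x, hu (bxor c x)]
  rw [signOf_xor] at hk
  linear_combination (8 : ℝ) * hk

end Summit.QuantumAdvantage.QuantumAdvantage.Theorems.CubicForrelation.NearExactIsExact
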